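/-
Origin: expansion seat `planner-pub-hodgecm-pv10-0`, handover 2026-08-18T03:54:32Z (`HOME/pub-hodgecm-pv10/lean/Pv10/IdeleClassGroup.lean`, md5 bb5b41cf, 231 lines);
landed by the gen-5 packager in gate run 20 as `HodgeCM/PerL34/IdeleClassGroup.lean` (verbatim).
-/
/-
Origin: planner-pub-hodgecm-pv10-0 (unit pub-hodgecm-pv10), HodgeCM publication cell, 2026-08-18.
LEMMAS.md §3 vocabulary D3 (Hecke characters of a CM field) — the part definable NOW over Mathlib's
adeles, and the openness input `hm` of node N15's E4 (`CharExtensionN15.lean` §4) for REAL ideles.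
-/
import Mathlib.NumberTheory.NumberField.AdeleRing
import Mathlib.Topology.Algebra.Group.Quotient
import Mathlib.Topology.Algebra.ContinuousMonoidHom
import Mathlib.Analysis.SpecialFunctions.Complex.Circle
import Literature.Topology.Algebra.RestrictedProduct.Units

/-!
# D3 (part): idele class group, unitary Hecke characters, and the openness input of N15/E4

Everything here is over Mathlib's `NumberField.AdeleRing (𝓞 K) K = InfiniteAdeleRing K × FiniteAdeleRing (𝓞 K) K`.

* `Units.isOpenEmbedding_map` — units of an open ring/monoid embedding embed openly (general lemma).
* `NumberField.integralAdeles K = ∏_v 𝒪_v`, `structureRingHom : ∏_v 𝒪_v →+* FiniteAdeleRing (𝓞 K) K`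
  (an open embedding), `ideleGroup K = 𝔸_Kˣ`, `principalIdeles K = image of Kˣ`,
  `IdeleClassGroup K = 𝔸_Kˣ / Kˣ`, `UnitaryHeckeCharacter K = (C_K →ₜ* circle)`.
* `infUnitsToClass : (InfiniteAdeleRing K)ˣ →* C_K`, `intUnitsToClass : (∏_v 𝒪_v)ˣ →* C_K` and
  `isOpenMap_infUnits_mul_intUnits` : `(x,u) ↦ [x]·[u] : K_∞^× × (∏_v 𝒪_v)^× → C_K` is an OPEN MAP —
  the hypothesis `hm` of `CharExtensionN15.exists_continuous_circleChar_extension_of_isOpenMap_mul`.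
-/

set_option autoImplicit false

noncomputable section

open Topology Filter Set

/-! ## Units of an open embedding -/

namespace Units

variable {A R : Type*} [Monoid A] [Monoid R] [TopologicalSpace A] [TopologicalSpace R]

omit [TopologicalSpace A] [TopologicalSpace R] in
/-- The range of `Units.map f` for an injective `f` is cut out by `val ∈ range f ∧ val⁻¹ ∈ range f`. -/
alias range_map_eq_of_injective := Literature.Topology.Algebra.RestrictedProduct.Units.range_map_eq_of_injective

/-- **Units of an open embedding of topological monoids form an open embedding.**  (For an open
subring `A ⊆ R`, e.g. `∏_v 𝒪_v ⊆ 𝔸_{K,f}`, this says `A^× ⊆ R^×` is open, for the units topologies.) -/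
alias isOpenEmbedding_map := Literature.Topology.Algebra.RestrictedProduct.Units.isOpenEmbedding_map

end Units

/-! ## Integral adeles, ideles, idele classes, unitary Hecke characters -/

namespace NumberField

open IsDedekindDomain IsDedekindDomain.HeightOneSpectrum
open scoped RestrictedProduct

variable (K : Type*) [Field K] [NumberField K]

/-- `∏_v 𝒪_v` over the finite places of `K` (product topology, a compact open subring of `𝔸_{K,f}`). -/
abbrev integralAdeles : Type _ := Π v : HeightOneSpectrum (𝓞 K), v.adicCompletionIntegers K

/-- The inclusion `∏_v 𝒪_v → 𝔸_{K,f}` (= `RestrictedProduct.structureMap`) as a ring homomorphism. -/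
def structureRingHom : integralAdeles K →+* FiniteAdeleRing (𝓞 K) K where
  toFun := RestrictedProduct.structureMap _ _ _
  map_one' := rfl
  map_mul' _ _ := rfl
  map_zero' := rfl
  map_add' _ _ := rfl

/-- (Ported verbatim from the HodgeCMPerL package; no docstring in the source.) -/
theorem structureRingHom_apply (x : integralAdeles K) (v : HeightOneSpectrum (𝓞 K)) :
    structureRingHom K x v = (x v : v.adicCompletion K) := rfl

/-- (Ported verbatim from the HodgeCMPerL package; no docstring in the source.) -/
theorem isOpenEmbedding_structureRingHom : IsOpenEmbedding (structureRingHom K) :=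
  RestrictedProduct.isOpenEmbedding_structureMap (fun _ => Valued.isOpen_valuationSubring _)

/-- `(∏_v 𝒪_v)^× → 𝔸_{K,f}^×` is an open embedding (units topologies). -/
theorem isOpenEmbedding_unitsMap_structureRingHom :
    IsOpenEmbedding (Units.map (structureRingHom K : integralAdeles K →* FiniteAdeleRing (𝓞 K) K)) :=
  Units.isOpenEmbedding_map _ (isOpenEmbedding_structureRingHom K)

/-- The idele group `𝔸_K^×` (units topology). -/
abbrev ideleGroup : Type _ := (AdeleRing (𝓞 K) K)ˣ

/-- The principal ideles: the image of `K^×` in `𝔸_K^×`. -/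
def principalIdeles : Subgroup (ideleGroup K) :=
  (Units.map (algebraMap K (AdeleRing (𝓞 K) K) : K →* AdeleRing (𝓞 K) K)).range

/-- The idele class group `C_K = 𝔸_K^× / K^×` (quotient topology; a topological abelian group). -/
abbrev IdeleClassGroup : Type _ := ideleGroup K ⧸ principalIdeles K

example : CommGroup (IdeleClassGroup K) := inferInstance
example : TopologicalSpace (IdeleClassGroup K) := inferInstance
example : IsTopologicalGroup (IdeleClassGroup K) := inferInstance

/-- Unitary Hecke characters of `K`: continuous homomorphisms `C_K → S¹`. -/
abbrev UnitaryHeckeCharacter : Type _ := ContinuousMonoidHom (IdeleClassGroup K) Circle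

/-- `𝔸_K^× ≃ₜ K_∞^× × 𝔸_{K,f}^×`. -/
def ideleGroupSplit : ideleGroup K ≃ₜ (InfiniteAdeleRing K)ˣ × (FiniteAdeleRing (𝓞 K) K)ˣ :=
  Homeomorph.prodUnits

/-- The same splitting as a group isomorphism. -/
def ideleGroupSplitMulEquiv : ideleGroup K ≃* (InfiniteAdeleRing K)ˣ × (FiniteAdeleRing (𝓞 K) K)ˣ :=
  MulEquiv.prodUnits

/-- (Ported verbatim from the HodgeCMPerL package; no docstring in the source.) -/
theorem ideleGroupSplit_apply (x : ideleGroup K) :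
    ideleGroupSplit K x = ideleGroupSplitMulEquiv K x := rfl

/-! ## The maps `K_∞^× → C_K`, `(∏_v 𝒪_v)^× → C_K` and the openness input of N15/E4 -/

/-- `K_∞^× → 𝔸_K^×`, `x ↦ (x, 1)`. -/
def infUnitsToIdele : (InfiniteAdeleRing K)ˣ →* ideleGroup K :=
  (ideleGroupSplitMulEquiv K).symm.toMonoidHom.comp (MonoidHom.inl _ _)

/-- `(∏_v 𝒪_v)^× → 𝔸_K^×`, `u ↦ (1, u)`. -/
def intUnitsToIdele : (integralAdeles K)ˣ →* ideleGroup K :=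
  (ideleGroupSplitMulEquiv K).symm.toMonoidHom.comp
    ((MonoidHom.inr _ _).comp
      (Units.map (structureRingHom K : integralAdeles K →* FiniteAdeleRing (𝓞 K) K)))

/-- `K_∞^× → C_K`. -/
def infUnitsToClass : (InfiniteAdeleRing K)ˣ →* IdeleClassGroup K :=
  (QuotientGroup.mk' (principalIdeles K)).comp (infUnitsToIdele K)

/-- `(∏_v 𝒪_v)^× → C_K`. -/
def intUnitsToClass : (integralAdeles K)ˣ →* IdeleClassGroup K :=
  (QuotientGroup.mk' (principalIdeles K)).comp (intUnitsToIdele K)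

/-- (Ported verbatim from the HodgeCMPerL package; no docstring in the source.) -/
theorem infUnitsToIdele_mul_intUnitsToIdele (x : (InfiniteAdeleRing K)ˣ) (u : (integralAdeles K)ˣ) :
    infUnitsToIdele K x * intUnitsToIdele K u =
      (ideleGroupSplitMulEquiv K).symm
        (x, Units.map (structureRingHom K : integralAdeles K →* FiniteAdeleRing (𝓞 K) K) u) := by
  simp only [infUnitsToIdele, intUnitsToIdele, MonoidHom.coe_comp, MulEquiv.coe_toMonoidHom,
    Function.comp_apply, MonoidHom.inl_apply, MonoidHom.inr_apply, ← map_mul, Prod.mk_mul_mk,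
    mul_one, one_mul]

/-- The map `(x,u) ↦ (x,1)·(1,u) : K_∞^× × (∏_v 𝒪_v)^× → 𝔸_K^×` is `split⁻¹ ∘ (id × units(structure map))`. -/
theorem infUnits_mul_intUnits_eq :
    (fun p : (InfiniteAdeleRing K)ˣ × (integralAdeles K)ˣ => infUnitsToIdele K p.1 * intUnitsToIdele K p.2) =
      (ideleGroupSplit K).symm ∘
        Prod.map id (Units.map (structureRingHom K : integralAdeles K →* FiniteAdeleRing (𝓞 K) K)) := by
  funext p
  rw [infUnitsToIdele_mul_intUnitsToIdele]
  rfl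

/-- `K_∞^× × (∏_v 𝒪_v)^× → 𝔸_K^×`, `(x,u) ↦ (x,u)`, is an OPEN map (indeed an open embedding). -/
theorem isOpenMap_infUnits_mul_intUnits_idele :
    IsOpenMap (fun p : (InfiniteAdeleRing K)ˣ × (integralAdeles K)ˣ =>
      infUnitsToIdele K p.1 * intUnitsToIdele K p.2) := by
  rw [infUnits_mul_intUnits_eq]
  exact (ideleGroupSplit K).symm.isOpenMap.comp
    (IsOpenMap.id.prodMap (isOpenEmbedding_unitsMap_structureRingHom K).isOpenMap)

/-- (Ported verbatim from the HodgeCMPerL package; no docstring in the source.) -/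
theorem isOpenEmbedding_infUnits_mul_intUnits_idele :
    IsOpenEmbedding (fun p : (InfiniteAdeleRing K)ˣ × (integralAdeles K)ˣ =>
      infUnitsToIdele K p.1 * intUnitsToIdele K p.2) := by
  rw [infUnits_mul_intUnits_eq]
  exact (ideleGroupSplit K).symm.isOpenEmbedding.comp
    (IsOpenEmbedding.id.prodMap (isOpenEmbedding_unitsMap_structureRingHom K))

/-- (Ported verbatim from the HodgeCMPerL package; no docstring in the source.) -/
theorem continuous_infUnitsToIdele : Continuous (infUnitsToIdele K) :=
  (ideleGroupSplit K).symm.continuous.comp (continuous_id.prodMk continuous_const)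

/-- (Ported verbatim from the HodgeCMPerL package; no docstring in the source.) -/
theorem continuous_intUnitsToIdele : Continuous (intUnitsToIdele K) :=
  (ideleGroupSplit K).symm.continuous.comp
    (continuous_const.prodMk ((isOpenEmbedding_unitsMap_structureRingHom K).continuous))

/-- (Ported verbatim from the HodgeCMPerL package; no docstring in the source.) -/
theorem continuous_infUnitsToClass : Continuous (infUnitsToClass K) :=
  QuotientGroup.continuous_mk.comp (continuous_infUnitsToIdele K)

/-- (Ported verbatim from the HodgeCMPerL package; no docstring in the source.) -/
theorem continuous_intUnitsToClass : Continuous (intUnitsToClass K) :=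
  QuotientGroup.continuous_mk.comp (continuous_intUnitsToIdele K)

/-- **The openness input `hm` of N15/E4 for real ideles.**  `(x,u) ↦ [x]·[u] : K_∞^× × (∏_v 𝒪_v)^× → C_K`
is an open map (open embedding into `𝔸_K^×` followed by the open quotient map `𝔸_K^× → C_K`). -/
theorem isOpenMap_infUnits_mul_intUnits :
    IsOpenMap (fun p : (InfiniteAdeleRing K)ˣ × (integralAdeles K)ˣ =>
      infUnitsToClass K p.1 * intUnitsToClass K p.2) := by
  have h : (fun p : (InfiniteAdeleRing K)ˣ × (integralAdeles K)ˣ =>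
        infUnitsToClass K p.1 * intUnitsToClass K p.2) =
      (QuotientGroup.mk : ideleGroup K → IdeleClassGroup K) ∘
        (fun p => infUnitsToIdele K p.1 * intUnitsToIdele K p.2) := by
    funext p
    simp only [infUnitsToClass, intUnitsToClass, MonoidHom.coe_comp, Function.comp_apply,
      QuotientGroup.mk'_apply, QuotientGroup.mk_mul]
  rw [h]
  exact QuotientGroup.isOpenMap_coe.comp (isOpenMap_infUnits_mul_intUnits_idele K)

/-- Neighbourhood form of the same input. -/
theorem image_infUnits_mul_intUnits_mem_nhds {s : Set ((InfiniteAdeleRing K)ˣ × (integralAdeles K)ˣ)}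
    (hs : s ∈ 𝓝 ((1 : (InfiniteAdeleRing K)ˣ), (1 : (integralAdeles K)ˣ))) :
    (fun p : (InfiniteAdeleRing K)ˣ × (integralAdeles K)ˣ =>
        infUnitsToClass K p.1 * intUnitsToClass K p.2) '' s ∈ 𝓝 (1 : IdeleClassGroup K) := by
  have h := (isOpenMap_infUnits_mul_intUnits K).image_mem_nhds hs
  have h1 : infUnitsToClass K ((1 : (InfiniteAdeleRing K)ˣ), (1 : (integralAdeles K)ˣ)).1 *
      intUnitsToClass K ((1 : (InfiniteAdeleRing K)ˣ), (1 : (integralAdeles K)ˣ)).2 =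
        (1 : IdeleClassGroup K) := by
    rw [map_one, map_one]
    exact mul_one (1 : IdeleClassGroup K)
  rwa [h1] at h

end NumberField

end
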